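import Mathlib.RingTheory.Length
import Mathlib.Algebra.Module.Torsion.Basic
import Mathlib.LinearAlgebra.FiniteDimensional.Lemmas
import Mathlib.Data.ZMod.Basic
import Mathlib.FieldTheory.Finite.Basic
import HarnessLib

/-!
# Two algebra bricks of the Kato-defect line on `(R≥)ᵖ`: the torsion/index shift of lengths, and
# "a non-trivial involution of `𝔽₂²` is free" (`ker(c − 1) = im(c − 1)`)
# (lead prover bsd-wall-rtt-p2 g10; `--supports stmt-BirchSwinnertonDyer-26074`; route-independent, closes nothing)

HONEST FRAMING. THEOREMS ONLY (no definition, no named fact, no `sorry`); pure commutative / linear algebra; nothing about any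
curve is asserted; BSD is not proved by any of this. No route (`Theses`) file is imported.

WHAT. The crux idea card `kato-defect-transport-at-two` (item stmt-BirchSwinnertonDyer-26074, crux `ResidualThetaCountLowerPureAtTwo`,
route `ResidualThetaTransportAtTwo`) names four First lemmas; (L2) `HerbrandCountTwo` is the tree's
`LambdaLowerBound.natCard_quotient_eq_pow_lambdaInvariant_mul_natCard_ker` (p615487) and (L4) `ArchimedeanVacuity` is
`ResidualLayer.archimedeanVacuity`; this file proves the remaining two VERBATIM:

* (L1) `torsionIndexShift` — for a module `M` over a commutative ring `R` and `e ∈ M` annihilated by no non-zero scalar,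
  `ℓ_R(M ⧸ Re) = ℓ_R(T) + ℓ_R((M ⧸ T) ⧸ R ē)` with `T = torsion_R M` (in `ℕ∞`): the engine of the card's bookkeeping
  `δ = h̄² − t̄ − ord(z̄)` (`R = 𝔽₂⟦T⟧`, `M = 𝐇¹_Iw,S₀(W[2])`, `e` = the residual zeta class). Proved for every commutative ring
  (`length_quotient_span_singleton_eq`, hypothesis `∀ r, r • e = 0 → r = 0`); the card's `[IsDomain R]` form is a specialisation.
* (L3) `nontrivialInvolutionIsFree` — for a `2`-dimensional `𝔽₂`-vector space `V` and a linear involution `c ≠ 1`: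
  `ker(c − 1) = range(c − 1)` (both are lines: `(c − 1)² = c² − 2c + 1 = 2(1 − c) = 0` over `𝔽₂`, so `range ≤ ker`, and
  rank–nullity). This is the freeness of `W[2] ≅ 𝔽₂[C₂]` under a complex conjugation when `Δ_W < 0`, whence all Tate
  cohomology of `⟨c⟩` on `W[2]` vanishes (the card's replacement for `cd₂ = 2` at `p = 2`).

References: [SerreGaloisCohomology1997] I.§2 (cohomology of cyclic groups; free modules are cohomologically trivial);
[Matsuno2008] Lemma 2.5; Kim–Lee–Ponsinet arXiv:1909.01764 Prop. 4.10 / §6 (the δ bookkeeping; cited in the card, not used here).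
-/

set_option autoImplicit false
-- D-0017: single-problem summit, so `Summit.BirchSwinnertonDyer.BirchSwinnertonDyer.…` repeats a namespace BY DESIGN.
set_option linter.dupNamespace false

namespace Summit.BirchSwinnertonDyer.BirchSwinnertonDyer.Theorems.KatoDefectTransport

universe u v

/-! ## §1. (L1) The torsion / index shift of lengths -/

section TorsionIndexShift

variable {R : Type u} [CommRing R] {M : Type v} [AddCommGroup M] [Module R M]

/-- An element annihilated by no non-zero scalar meets the torsion submodule trivially: if `r • e` is torsion then
`r • e = 0`. (For `s ∈ R⁰` with `s • (r • e) = 0` we get `(s * r) • e = 0`, so `s * r = 0`, so `r = 0`.) [folklore] -/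
theorem smul_eq_zero_of_smul_mem_torsion {e : M} (he : ∀ r : R, r • e = 0 → r = 0) {r : R}
    (hr : r • e ∈ Submodule.torsion R M) : r • e = 0 := by
  obtain ⟨s, hs⟩ := (Submodule.mem_torsion_iff (r • e)).mp hr
  have hsr : ((s : R) * r) • e = 0 := by rw [mul_smul]; exact hs
  have h0 : (s : R) * r = 0 := he _ hsr
  have hr0 : r = 0 := (mem_nonZeroDivisors_iff_right.mp s.2) r (by rwa [mul_comm] at h0)
  rw [hr0, zero_smul]

/-- **Torsion / index shift (general commutative ring).** Let `M` be an `R`-module, `T = torsion_R M` (torsion by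
non-zero-divisors) and `e ∈ M` with `r • e = 0 → r = 0`. Then
`ℓ_R(M ⧸ Re) = ℓ_R(T) + ℓ_R((M ⧸ T) ⧸ R ē)` in `ℕ∞`, where `ē` is the image of `e` in `M ⧸ T`: the sequence
`0 → T → M ⧸ Re → (M ⧸ T) ⧸ R ē → 0` is exact (`T ∩ Re = 0` by `smul_eq_zero_of_smul_mem_torsion`) and length is additive
(`Module.length_eq_add_of_exact`). [folklore] -/
theorem length_quotient_span_singleton_eq (e : M) (he : ∀ r : R, r • e = 0 → r = 0) :
    Module.length R (M ⧸ Submodule.span R {e}) =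
      Module.length R (Submodule.torsion R M) +
        Module.length R ((M ⧸ Submodule.torsion R M) ⧸
          Submodule.span R {(Submodule.torsion R M).mkQ e}) := by
  set T := Submodule.torsion R M with hT
  set π := T.mkQ with hπ
  -- the two maps of the short exact sequence
  let f : T →ₗ[R] M ⧸ Submodule.span R {e} := (Submodule.span R {e}).mkQ ∘ₗ T.subtype
  have hle : Submodule.span R {e} ≤ Submodule.comap π (Submodule.span R {π e}) := by
    rw [Submodule.span_le]
    intro x hx
    rw [Set.mem_singleton_iff] at hx
    rw [hx, SetLike.mem_coe, Submodule.mem_comap]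
    exact Submodule.mem_span_singleton_self _
  let g : M ⧸ Submodule.span R {e} →ₗ[R] (M ⧸ T) ⧸ Submodule.span R {π e} :=
    Submodule.mapQ _ _ π hle
  -- injectivity of `f`: `T ∩ Re = 0`
  have hf : Function.Injective f := by
    refine (injective_iff_map_eq_zero f).mpr fun t ht ↦ ?_
    have ht' : (t : M) ∈ Submodule.span R {e} := by
      simpa only [f, LinearMap.coe_comp, Function.comp_apply, Submodule.coe_subtype, Submodule.mkQ_apply,
        Submodule.Quotient.mk_eq_zero] using ht
    obtain ⟨r, hr⟩ := Submodule.mem_span_singleton.mp ht'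
    have hmem : r • e ∈ Submodule.torsion R M := by rw [hr]; exact t.2
    have h0 := smul_eq_zero_of_smul_mem_torsion he hmem
    exact Subtype.ext (by rw [← hr, h0]; rfl)
  -- surjectivity of `g`
  have hg : Function.Surjective g := by
    intro y
    obtain ⟨z, rfl⟩ := Submodule.mkQ_surjective _ y
    obtain ⟨m, rfl⟩ := Submodule.mkQ_surjective _ z
    exact ⟨Submodule.Quotient.mk m, rfl⟩
  -- exactness in the middle
  have hex : Function.Exact f g := by
    intro z
    constructor
    · intro hz
      obtain ⟨m, rfl⟩ := Submodule.mkQ_surjective _ z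
      have hz' : π m ∈ Submodule.span R {π e} := by
        simpa only [g, Submodule.mkQ_apply, Submodule.mapQ_apply, Submodule.Quotient.mk_eq_zero] using hz
      obtain ⟨r, hr⟩ := Submodule.mem_span_singleton.mp hz'
      have hmT : m - r • e ∈ T := by
        rw [← Submodule.Quotient.mk_eq_zero, ← Submodule.mkQ_apply, map_sub, map_smul, ← hπ, hr, sub_self]
      refine ⟨⟨m - r • e, hmT⟩, ?_⟩
      simp only [f, LinearMap.coe_comp, Function.comp_apply, Submodule.coe_subtype, Submodule.mkQ_apply]
      rw [Submodule.Quotient.eq]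
      refine Submodule.mem_span_singleton.mpr ⟨-r, ?_⟩
      simp [sub_sub_cancel_left, neg_smul]
    · rintro ⟨t, rfl⟩
      simp only [f, g, LinearMap.coe_comp, Function.comp_apply, Submodule.coe_subtype, Submodule.mkQ_apply,
        Submodule.mapQ_apply, Submodule.Quotient.mk_eq_zero]
      have : π (t : M) = 0 := by rw [hπ, Submodule.mkQ_apply, Submodule.Quotient.mk_eq_zero]; exact t.2
      rw [this]
      exact Submodule.zero_mem _
  exact Module.length_eq_add_of_exact f g hf hg hex

/-- **(L1) `TorsionIndexShift`** — First lemma (L1) of the crux idea card `kato-defect-transport-at-two` on item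
stmt-BirchSwinnertonDyer-26074, VERBATIM: for a domain `R`, an `R`-module `M` and `e ∈ M` with `r • e = 0 → r = 0`,
`ℓ_R(M ⧸ Re) = ℓ_R(torsion M) + ℓ_R((M ⧸ torsion M) ⧸ R ē)`. Specialisation of `length_quotient_span_singleton_eq`.
[folklore] -/
theorem torsionIndexShift : ∀ (R : Type) [CommRing R] [IsDomain R] (M : Type) [AddCommGroup M] [Module R M] (e : M),
    (∀ r : R, r • e = 0 → r = 0) →
      Module.length R (M ⧸ Submodule.span R {e}) =
        Module.length R (Submodule.torsion R M) +
          Module.length R ((M ⧸ Submodule.torsion R M) ⧸ Submodule.span R {(Submodule.torsion R M).mkQ e}) :=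
  fun _ _ _ _ _ _ e he ↦ length_quotient_span_singleton_eq e he

end TorsionIndexShift

/-! ## §2. (L3) A non-trivial involution of `𝔽₂²` is free -/

section Involution

variable {V : Type u} [AddCommGroup V] [Module (ZMod 2) V]

/-- Over `𝔽₂`, `(c − 1)² = 0` for a linear involution `c` (`c² − 2c + 1 = 2(1 − c) = 0`). [folklore] -/
theorem sub_id_comp_sub_id_eq_zero (c : V →ₗ[ZMod 2] V) (hc : c ∘ₗ c = LinearMap.id) :
    (c - LinearMap.id) ∘ₗ (c - LinearMap.id) = 0 := by
  ext x
  have hcc : c (c x) = x := by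
    have := LinearMap.congr_fun hc x
    simpa only [LinearMap.coe_comp, Function.comp_apply, LinearMap.id_coe, id_eq] using this
  simp only [LinearMap.coe_comp, Function.comp_apply, LinearMap.sub_apply, LinearMap.id_coe, id_eq, map_sub, hcc,
    LinearMap.zero_apply]
  -- `x - c x - (c x - x) = 2 • (x - c x) = 0`
  have h2 : (x - c x) + (x - c x) = 0 := ZModModule.add_self _
  calc x - c x - (c x - x) = (x - c x) + (x - c x) := by abel
    _ = 0 := h2

/-- **(L3) `NontrivialInvolutionIsFree`** — First lemma (L3) of the crux idea card `kato-defect-transport-at-two` on item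
stmt-BirchSwinnertonDyer-26074, VERBATIM: for a `2`-dimensional `𝔽₂`-space `V` and a linear involution `c ≠ 1`,
`ker(c − 1) = range(c − 1)`. Proof: `(c − 1)² = 0` gives `range ≤ ker`; `c ≠ 1` gives `range ≠ 0`; rank–nullity
`dim ker + dim range = 2` then forces `dim ker = dim range = 1`. (Equivalently `V ≅ 𝔽₂[C₂]` is free over `⟨c⟩`, so
`Ĥ^i(⟨c⟩, V) = 0` for all `i`; used with `c` = complex conjugation on `W[2]`, `Δ_W < 0`.)
[cite: SerreGaloisCohomology1997, I §2] -/
theorem nontrivialInvolutionIsFree : ∀ (V : Type) [AddCommGroup V] [Module (ZMod 2) V],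
    Module.finrank (ZMod 2) V = 2 → ∀ (c : V →ₗ[ZMod 2] V), c ∘ₗ c = LinearMap.id → c ≠ LinearMap.id →
      LinearMap.ker (c - LinearMap.id) = LinearMap.range (c - LinearMap.id) := by
  intro V _ _ hV c hc hne
  haveI : Module.Finite (ZMod 2) V := Module.finite_of_finrank_eq_succ hV
  set N := c - LinearMap.id with hN
  -- `range N ≤ ker N`
  have hle : LinearMap.range N ≤ LinearMap.ker N := by
    rintro _ ⟨x, rfl⟩
    rw [LinearMap.mem_ker]
    have := LinearMap.congr_fun (sub_id_comp_sub_id_eq_zero c hc) x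
    simpa only [LinearMap.coe_comp, Function.comp_apply, LinearMap.zero_apply] using this
  -- `N ≠ 0`
  have hN0 : N ≠ 0 := by
    intro h
    apply hne
    rw [hN, sub_eq_zero] at h
    exact h
  -- rank–nullity
  have hrn : Module.finrank (ZMod 2) (LinearMap.range N) + Module.finrank (ZMod 2) (LinearMap.ker N) = 2 := by
    rw [LinearMap.finrank_range_add_finrank_ker, hV]
  have hr_pos : 0 < Module.finrank (ZMod 2) (LinearMap.range N) := by
    rw [Module.finrank_pos_iff_exists_ne_zero]
    by_contra hall
    push Not at hall
    apply hN0
    ext x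
    have := hall ⟨N x, LinearMap.mem_range_self N x⟩
    simpa using this
  have hrk : Module.finrank (ZMod 2) (LinearMap.range N) ≤ Module.finrank (ZMod 2) (LinearMap.ker N) :=
    Submodule.finrank_mono hle
  symm
  apply Submodule.eq_of_le_of_finrank_eq hle
  omega

end Involution

end Summit.BirchSwinnertonDyer.BirchSwinnertonDyer.Theorems.KatoDefectTransport
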